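import Literature.Analysis.Fourier.HilbertTransformCircle
import HarnessLib

/-!
# Kernel representations of the periodic Hilbert transform of an ODD function at the origin and at the antipode

Topic `Literature/Analysis/Fourier`. For the operator `hilbertTransformCircle` (p.v. `cot(t/2)` kernel, `H sin = −cos`) and an ODD
`f` (the symmetry class of the Okamoto–Sakajo–Wunsch / gCLM profiles on the circle):

* `Hf(0) = −(1/π) ∫₀^π f(y) cot(y/2) dy`  (`hilbertTransformCircle_zero_of_odd`);
* if `f` is moreover `2π`-periodic, `Hf(π) = (1/π) ∫₀^π f(y) tan(y/2) dy`  (`hilbertTransformCircle_pi_of_odd_periodic`);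
* hence for `f < 0` on `(0, π)` (and the two kernels integrable): `Hf(0) > 0 > Hf(π)`
  (`hilbertTransformCircle_zero_pos`, `hilbertTransformCircle_pi_neg`).

These are the two kernel identities and the sign pattern «`H₀ > 0 > Hπ`» of the ANALYTIC STEP recorded (and deliberately left
untyped for want of the operator) in `Literature/Analysis/FluidPDE/OkamotoSakajoWunsch2008/AprioriBounds.lean` (cell pub-oswblow LAW.md §4
THEOREM E2: every quantised OSW parameter satisfies `1/p < a < 1`). [cite: OkamotoSakajoWunsch2008, §1 (the operator `H` with kernel
`(1/2π) cot((x−y)/2)`)] No new definition.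
-/

namespace Literature.Analysis.Fourier

open _root_.MeasureTheory Set Filter intervalIntegral
open scoped Real Topology

/-- **Origin representation**: for odd `f`, `Hf(0) = −π⁻¹ ∫₀^π f(y)·cot(y/2) dy`. [cite: OkamotoSakajoWunsch2008, §1] -/
theorem hilbertTransformCircle_zero_of_odd {f : ℝ → ℝ} (hf : ∀ y, f (-y) = -f y) :
    hilbertTransformCircle f 0 = -π⁻¹ * ∫ y in (0 : ℝ)..π, f y * (Real.cos (y / 2) / Real.sin (y / 2)) := by
  unfold hilbertTransformCircle
  have h : (fun t : ℝ => (f (0 - t) - f (0 + t)) * (Real.cos (t / 2) / Real.sin (t / 2))) =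
      fun t => (-2 : ℝ) * (f t * (Real.cos (t / 2) / Real.sin (t / 2))) := by
    funext t
    rw [zero_sub, zero_add, hf]
    ring
  rw [h, intervalIntegral.integral_const_mul]
  have hπ : (π : ℝ) ≠ 0 := Real.pi_ne_zero
  field_simp

/-- **Antipode representation**: for odd `2π`-periodic `f`, `Hf(π) = π⁻¹ ∫₀^π f(y)·tan(y/2) dy`
(`f(π+t) = −f(π−t)`, then `y = π − t` and `cot((π−y)/2) = tan(y/2)`). [cite: OkamotoSakajoWunsch2008, §1] -/
theorem hilbertTransformCircle_pi_of_odd_periodic {f : ℝ → ℝ} (hf : ∀ y, f (-y) = -f y) (hper : ∀ y, f (y + 2 * π) = f y) :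
    hilbertTransformCircle f π = π⁻¹ * ∫ y in (0 : ℝ)..π, f y * (Real.sin (y / 2) / Real.cos (y / 2)) := by
  unfold hilbertTransformCircle
  have hanti : ∀ t, f (π + t) = -f (π - t) := by
    intro t
    have h1 : f (π + t) = f (π + t - 2 * π + 2 * π) := by ring_nf
    rw [h1, hper, show π + t - 2 * π = -(π - t) by ring, hf]
  have h : (fun t : ℝ => (f (π - t) - f (π + t)) * (Real.cos (t / 2) / Real.sin (t / 2))) =
      fun t => (2 : ℝ) * ((fun y => f y * (Real.cos ((π - y) / 2) / Real.sin ((π - y) / 2))) (π - t)) := by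
    funext t
    simp only [hanti, sub_sub_cancel]
    ring
  rw [h, intervalIntegral.integral_const_mul,
    intervalIntegral.integral_comp_sub_left (fun y => f y * (Real.cos ((π - y) / 2) / Real.sin ((π - y) / 2))) π,
    sub_self, sub_zero]
  have hk : ∀ y, Real.cos ((π - y) / 2) / Real.sin ((π - y) / 2) = Real.sin (y / 2) / Real.cos (y / 2) := by
    intro y
    rw [show (π - y) / 2 = π / 2 - y / 2 by ring, Real.cos_pi_div_two_sub, Real.sin_pi_div_two_sub]
  simp_rw [hk]
  have hπ : (π : ℝ) ≠ 0 := Real.pi_ne_zero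
  field_simp

/-- **`H₀ > 0`**: for odd `f` negative on `(0, π)` with `f·cot(·/2)` interval-integrable on `[0, π]`, `Hf(0) > 0`.
[cite: OkamotoSakajoWunsch2008, §1] -/
theorem hilbertTransformCircle_zero_pos {f : ℝ → ℝ} (hf : ∀ y, f (-y) = -f y) (hneg : ∀ y ∈ Ioo (0 : ℝ) π, f y < 0)
    (hint : IntervalIntegrable (fun y => f y * (Real.cos (y / 2) / Real.sin (y / 2))) volume 0 π) :
    0 < hilbertTransformCircle f 0 := by
  rw [hilbertTransformCircle_zero_of_odd hf]
  have hI : ∫ y in (0 : ℝ)..π, f y * (Real.cos (y / 2) / Real.sin (y / 2)) < 0 := by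
    have hneg' : ∀ y ∈ Ioo (0 : ℝ) π, 0 < -(f y * (Real.cos (y / 2) / Real.sin (y / 2))) := by
      intro y hy
      have hs : 0 < Real.sin (y / 2) := Real.sin_pos_of_pos_of_lt_pi (by linarith [hy.1]) (by linarith [hy.2, Real.pi_pos])
      have hc : 0 < Real.cos (y / 2) := Real.cos_pos_of_mem_Ioo ⟨by linarith [hy.1, Real.pi_pos], by linarith [hy.2]⟩
      have := hneg y hy
      nlinarith [div_pos hc hs, mul_neg_of_neg_of_pos this (div_pos hc hs)]
    have hint' : IntervalIntegrable (fun y => -(f y * (Real.cos (y / 2) / Real.sin (y / 2)))) volume 0 π := hint.neg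
    have h := intervalIntegral.intervalIntegral_pos_of_pos_on hint' hneg' Real.pi_pos
    rw [intervalIntegral.integral_neg] at h
    linarith
  have hπ : 0 < π⁻¹ := inv_pos.2 Real.pi_pos
  nlinarith [mul_pos hπ (neg_pos.2 hI)]

/-- **`Hπ < 0`**: for odd `2π`-periodic `f` negative on `(0, π)` with `f·tan(·/2)` interval-integrable on `[0, π]`, `Hf(π) < 0`.
[cite: OkamotoSakajoWunsch2008, §1] -/
theorem hilbertTransformCircle_pi_neg {f : ℝ → ℝ} (hf : ∀ y, f (-y) = -f y) (hper : ∀ y, f (y + 2 * π) = f y)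
    (hneg : ∀ y ∈ Ioo (0 : ℝ) π, f y < 0)
    (hint : IntervalIntegrable (fun y => f y * (Real.sin (y / 2) / Real.cos (y / 2))) volume 0 π) :
    hilbertTransformCircle f π < 0 := by
  rw [hilbertTransformCircle_pi_of_odd_periodic hf hper]
  have hI : ∫ y in (0 : ℝ)..π, f y * (Real.sin (y / 2) / Real.cos (y / 2)) < 0 := by
    have hneg' : ∀ y ∈ Ioo (0 : ℝ) π, 0 < -(f y * (Real.sin (y / 2) / Real.cos (y / 2))) := by
      intro y hy
      have hs : 0 < Real.sin (y / 2) := Real.sin_pos_of_pos_of_lt_pi (by linarith [hy.1]) (by linarith [hy.2, Real.pi_pos])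
      have hc : 0 < Real.cos (y / 2) := Real.cos_pos_of_mem_Ioo ⟨by linarith [hy.1, Real.pi_pos], by linarith [hy.2]⟩
      have := hneg y hy
      nlinarith [div_pos hs hc, mul_neg_of_neg_of_pos this (div_pos hs hc)]
    have hint' : IntervalIntegrable (fun y => -(f y * (Real.sin (y / 2) / Real.cos (y / 2)))) volume 0 π := hint.neg
    have h := intervalIntegral.intervalIntegral_pos_of_pos_on hint' hneg' Real.pi_pos
    rw [intervalIntegral.integral_neg] at h
    linarith
  have hπ : 0 < π⁻¹ := inv_pos.2 Real.pi_pos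
  nlinarith [mul_pos hπ (neg_pos.2 hI)]

end Literature.Analysis.Fourier
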